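import Mathlib.RingTheory.IsTensorProduct
import Mathlib.LinearAlgebra.Basis.VectorSpace

/-!
# Route LinearSystemTorelli — crux `LocalTubeSpan` (stmt-HodgeConjecture-2490): natural retraction of a base change

Helper file (`--supports stmt-HodgeConjecture-2490`, line `Sketch` of the crux chain, cycle 4
"portability of cyclic detection", stub `stub_baseChangeRetraction`).  The line's injectivity
theorems for Schnell's third map `H¹(G, V) → ∏_g V/(g - 1)V` ("cyclic detection") are over `ℚ`;
the tree's hyperplane-section local systems are over `ℂ` with a fibrewise `ℚ`-structure.  To move
detection DOWN along an extension of scalars `k → K` one retracts `V' = K ⊗_k V` onto `V`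
equivariantly; this file supplies the pure linear algebra of that retraction, stated for an
arbitrary base change in Mathlib's sense (`IsBaseChange K i` for a `k`-linear `i : V → V'`, i.e.
`K ⊗_k V ≃ V'`, `c ⊗ x ↦ c • i x`):

* `localTubeSpan_exists_retraction_of_isBaseChange` — for a field `k` and a non-trivial
  commutative `k`-algebra `K` there is a `k`-linear retraction `P : V' → V` of `i` (`P ∘ i = id`)
  which is NATURAL for every compatible pair (`f : V → V` `k`-linear, `f' : V' → V'` `K`-linear
  with `i ∘ f = f' ∘ i` ⇒ `P ∘ f' = f ∘ P`).  With `f = ρ(g)`, `f' = ρ'(g)` (an equivariant base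
  change of representations) `P` is a `G`-equivariant retraction `V' → V`.

Construction: `k → K` is injective (`k` a field, `K ≠ 0`), so it has a `k`-linear retraction
`r : K → k`; put `P = (r ⊗ id) ∘ e⁻¹ : V' ≃ K ⊗_k V → k ⊗_k V = V` for the equivalence
`e : K ⊗_k V ≃ V'` of the base change.  Then `P (i x) = r(1) • x = x`, a compatible `f'` is
`e ∘ (id ⊗ f) ∘ e⁻¹`, and `r ⊗ id` commutes with `id ⊗ f`.  Pure linear algebra over Mathlib; no
named facts.
-/

-- `Summit.HodgeConjecture.HodgeConjecture.Theorems` is the mandated namespace (single-conjunct summit: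
-- Sub = Summit), which `linter.dupNamespace` flags on every declaration; the lakefile turns the
-- linter off tree-wide (weak option), restated here so stand-alone elaboration is warning-free too.
set_option linter.dupNamespace false

noncomputable section

open scoped TensorProduct

namespace Summit.HodgeConjecture.HodgeConjecture.Theorems

universe u v w

/-- **Natural retraction of a base change.**  For a field `k`, a non-trivial commutative
`k`-algebra `K` and a base change `i : V → V'` (`IsBaseChange K i`, i.e. `K ⊗_k V ≃ V'`) there is
a `k`-linear retraction `P : V' → V` of `i` (`P (i x) = x`) which is natural for every compatible
pair `(f, f')` (`f` `k`-linear on `V`, `f'` `K`-linear on `V'`, `i ∘ f = f' ∘ i` ⇒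
`P ∘ f' = f ∘ P`).  (`P = (r ⊗ id) ∘ e⁻¹` for a `k`-linear retraction `r : K → k` of `k → K` and
the equivalence `e : K ⊗_k V ≃ V'` of the base change.) [folklore] -/
theorem localTubeSpan_exists_retraction_of_isBaseChange {k K : Type u} [Field k] [CommRing K]
    [Nontrivial K] [Algebra k K] {V : Type v} [AddCommGroup V] [Module k V]
    {V' : Type w} [AddCommGroup V'] [Module k V'] [Module K V'] [IsScalarTower k K V']
    (i : V →ₗ[k] V') (hi : IsBaseChange K i) :
    ∃ P : V' →ₗ[k] V, (∀ x : V, P (i x) = x) ∧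
      ∀ (f : V →ₗ[k] V) (f' : V' →ₗ[K] V'), (∀ x : V, i (f x) = f' (i x)) →
        ∀ x' : V', P (f' x') = f (P x') := by
  -- a `k`-linear retraction `r : K → k` of the (injective) structure map `k → K`
  obtain ⟨r, hr⟩ : ∃ r : K →ₗ[k] k, r.comp (Algebra.linearMap k K) = LinearMap.id :=
    LinearMap.exists_leftInverse_of_injective (Algebra.linearMap k K)
      (LinearMap.ker_eq_bot_of_injective (algebraMap k K).injective)
  have hr1 : r 1 = 1 := by simpa using LinearMap.congr_fun hr 1
  -- the equivalence of the base change, as a `k`-linear equivalence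
  let e : K ⊗[k] V ≃ₗ[K] V' := hi.equiv
  let ek : K ⊗[k] V ≃ₗ[k] V' := e.restrictScalars k
  -- `Q = lid ∘ (r ⊗ id) : K ⊗_k V → k ⊗_k V ≃ V` and the retraction `P = Q ∘ e⁻¹`
  let Q : K ⊗[k] V →ₗ[k] V := (TensorProduct.lid k V).toLinearMap ∘ₗ r.rTensor V
  have hQ : ∀ (c : K) (x : V), Q (c ⊗ₜ x) = r c • x := fun c x => by
    simp only [Q, LinearMap.comp_apply, LinearMap.rTensor_tmul, LinearEquiv.coe_coe,
      TensorProduct.lid_tmul]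
  let P : V' →ₗ[k] V := Q ∘ₗ ek.symm.toLinearMap
  have hP : ∀ x' : V', P x' = Q (e.symm x') := fun x' => rfl
  refine ⟨P, fun x => ?_, fun f f' hff' x' => ?_⟩
  · -- `P (i x) = r 1 • x = x`
    rw [hP, IsBaseChange.equiv_symm_apply, hQ, hr1, one_smul]
  · -- naturality: `e⁻¹ ∘ f' = (id ⊗ f) ∘ e⁻¹` and `Q ∘ (id ⊗ f) = f ∘ Q`
    have key : ∀ t : K ⊗[k] V, f' (e t) = e (f.baseChange K t) := by
      intro t
      induction t using TensorProduct.induction_on with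
      | zero => simp only [map_zero]
      | tmul c x =>
          rw [LinearMap.baseChange_tmul, IsBaseChange.equiv_tmul, IsBaseChange.equiv_tmul,
            map_smul, hff']
      | add t₁ t₂ h₁ h₂ => simp only [map_add, h₁, h₂]
    have hsymm : e.symm (f' x') = f.baseChange K (e.symm x') := by
      apply e.injective
      rw [LinearEquiv.apply_symm_apply, ← key, LinearEquiv.apply_symm_apply]
    have hnat : ∀ t : K ⊗[k] V, Q (f.baseChange K t) = f (Q t) := by
      intro t
      induction t using TensorProduct.induction_on with
      | zero => simp only [map_zero]
      | tmul c x => rw [LinearMap.baseChange_tmul, hQ, hQ, map_smul]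
      | add t₁ t₂ h₁ h₂ => simp only [map_add, h₁, h₂]
    rw [hP, hP, hsymm, hnat]

end Summit.HodgeConjecture.HodgeConjecture.Theorems

end
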